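import Mathlib
import Literature.Analysis.FluidPDE.LinearizedNSTorus
import Literature.Analysis.FunctionSpaces.TorusFluidGlue
import Literature.Analysis.FunctionSpaces.TorusSpaceTime
import HarnessLib

/-!
# Virtual periods of time-periodic Navier–Stokes solutions on the flat torus
(Fiedler 1988, Def. 1.2; Chow–Mallet-Paret–Yorke)

Definitions module continuing `Literature.Analysis.FluidPDE.LinearizedNSTorus` (the linearised
operator `L(ν, u_S)` at a steady state, Fiedler's unstable dimension `E` and centres) with the second
half of the vocabulary of Fiedler's global Hopf bifurcation theorem (LNM 1309, Thm 2.10: *"C contains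
periodic solutions with arbitrarily large virtual periods"*), for the incompressible Navier–Stokes
system on `T^d`, in the classical (smooth, with-pressure) formulation of the tree:

* `Torus.IsLinearizedNSSolutionAlong ν u w q` — the **linearised Navier–Stokes problem along a
  time-dependent classical solution** `u` (Fiedler (1.32), `ẏ = D_x f(λ, x(t)) y`):
  `∂ₜw = νΔw − (u(t)·∇)w − (w·∇)u(t) − ∇q` on `ℝ × T^d` with `w`, `q` jointly smooth, `w(t)`
  divergence free and mean zero (complex fields, the typing of `Torus.linearizedNSOperator`; this is
  the idiom already used by `Literature.Analysis.FluidPDE.PeriodicNSOrbitPersists`).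
* `Torus.IsVirtualPeriod ν u T` — **`T > 0` is a virtual period of `u`** (Fiedler Def. 1.2 with
  trivial symmetry group, due to Chow–Mallet-Paret–Yorke): some solution `w` of the linearised
  problem along `u` makes the PAIR `t ↦ (u t, w t)` have MINIMAL period `T`.
* Proved API: `isLinearizedNSSolutionAlong_zero`; `IsVirtualPeriod.pos`, `IsVirtualPeriod.periodic`;
  `isVirtualPeriod_of_minimalPeriod` (the minimal period of `u` is a virtual period: `w = 0`);
  complex homogeneity of the linearised operator (`linearizedNSOperator_const_smul` and the pieces
  `laplacian_const_smulC`, `convect_const_smulC`, `stretch_const_smul`, `gradientC_const_smul`,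
  `divergenceC_const_smul`); the normal modes `e^{μt} w₀` of an eigenpair solve the linearised
  problem along a steady state (`isLinearizedNSSolutionAlong_exp_smul`); and the easy half of
  Fiedler's Lemma 4.8: **a steady state whose linearisation has an eigenvalue `μ ∈ iℝ ∖ {0}` (a
  centre) has the virtual period `2π/|Im μ|`** (`IsLinNSEigenvalue.isVirtualPeriod_const`).

## Design notes

* Complex versus real `w`. Fiedler's `y` is real. Allowing complex `w` does not change the set of
  virtual periods: a real solution is a complex one, and if `w = y₁ + i y₂` makes `(u, w)` have
  minimal period `T`, then for all but finitely many real `c` the real solution `y₁ + c y₂` does too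
  (the candidate minimal periods `T/m` are finitely many and each `m > 1` can occur for at most one
  `c`). Complex typing lets the definition reuse `Torus.linearizedNSOperator` verbatim.
* Minimal period is phrased elementarily (`T` is a period of the pair and no `T' ∈ (0,T)` is), with
  Mathlib's `Function.Periodic` on the pair-valued map `t ↦ (u t, w t)`.
* Mathlib (grepped `virtual period`, `Floquet`, `linearis`): nothing; the tree has the steady
  linearisation only (`LinearizedNSTorus`).

## References

* B. Fiedler, *Global Bifurcation of Periodic Solutions with Symmetry*, LNM 1309 (1988), §1.4
  Def. 1.2 and (1.32) (virtual period), §4 Lemma 4.8 (stationary solutions have a virtual period iff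
  the linearisation has a purely imaginary non-zero eigenvalue), Thm 2.10 (2.30.b). [Fiedler1988]
* S.-N. Chow, J. Mallet-Paret, J. A. Yorke, *Global Hopf bifurcation from a multiple eigenvalue*,
  Nonlinear Anal. 2 (1978) 753–763; J. Mallet-Paret, J. A. Yorke, *Snakes*, J. Differential
  Equations 43 (1982) 419–450 (origin of virtual periods). [ChowMalletParetYorke1978]
  [MalletParetYorke1982]
-/

noncomputable section

open scoped BigOperators Topology
open Set Function MeasureTheory

namespace Literature.Analysis.FluidPDE

namespace Torus

open Literature.Analysis.FunctionSpaces

variable {d : Type*} [Fintype d] [DecidableEq d]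

/-! ### The linearised problem along a solution; virtual periods -/

/-- **The linearised Navier–Stokes problem along a time-dependent classical solution `u`** of
`NS_ν` on `ℝ × T^d` (Fiedler 1988, (1.32): `ẏ(t) = D_x f(λ, x(t)) y(t)`): the complex velocity
`w : ℝ → T^d → ℂ^d` and pressure `q : ℝ → T^d → ℂ` are jointly smooth on `ℝ × T^d`, every slice
`w(t)` is divergence free and has zero mean, and
`∂ₜw(t,x) = νΔw(t,x) − (u(t)·∇)w(t,x) − (w(t)·∇)u(t)(x) − ∇q(t,x)` pointwise
(`Torus.linearizedNSOperator ν (u t)`; the idiom of `PeriodicNSOrbitPersists`).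
[cite: Fiedler1988, §1.4 Def. 1.2 (1.32)] -/
def IsLinearizedNSSolutionAlong (ν : ℝ) (u : ℝ → UnitAddTorus d → EuclideanSpace ℝ d)
    (w : ℝ → UnitAddTorus d → EuclideanSpace ℂ d) (q : ℝ → UnitAddTorus d → ℂ) : Prop :=
  FunctionSpaces.Torus.IsSmoothSpaceTimeOn univ w ∧ FunctionSpaces.Torus.IsSmoothSpaceTimeOn univ q ∧
    (∀ t, IsDivFreeC (w t)) ∧ (∀ t, FunctionSpaces.Torus.HasZeroMean (w t)) ∧
    ∀ t x, FunctionSpaces.Torus.timeDerivWithin univ w t x = linearizedNSOperator ν (u t) (w t) (q t) x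

/-- **Virtual period** (Fiedler 1988, Def. 1.2 with trivial symmetry group; Chow–Mallet-Paret–Yorke):
`T > 0` is a virtual period of the solution `u` of `NS_ν` if there is a solution `w` (pressure `q`) of
the linearised problem along `u` such that the pair `t ↦ (u t, w t)` has minimal period `T` — `T`
is a period and no `T' ∈ (0, T)` is. With `w = 0` the minimal period of a periodic `u` is a virtual
period (`isVirtualPeriod_of_minimalPeriod`); a stationary `u` has a virtual period iff its
linearisation has a purely imaginary non-zero eigenvalue (Fiedler Lemma 4.8; the "if" half is
`IsLinNSEigenvalue.isVirtualPeriod_const`). [cite: Fiedler1988, §1.4 Def. 1.2] -/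
def IsVirtualPeriod (ν : ℝ) (u : ℝ → UnitAddTorus d → EuclideanSpace ℝ d) (T : ℝ) : Prop :=
  0 < T ∧ ∃ (w : ℝ → UnitAddTorus d → EuclideanSpace ℂ d) (q : ℝ → UnitAddTorus d → ℂ),
    IsLinearizedNSSolutionAlong ν u w q ∧ Periodic (fun t => (u t, w t)) T ∧
      ∀ T', 0 < T' → T' < T → ¬ Periodic (fun t => (u t, w t)) T'

/-! ### Basic API -/

section API

variable (ν : ℝ) (u : ℝ → UnitAddTorus d → EuclideanSpace ℝ d)

/-- The zero pair `w = 0`, `q = 0` solves the linearised problem along any `u`. [folklore] -/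
theorem isLinearizedNSSolutionAlong_zero :
    IsLinearizedNSSolutionAlong ν u (fun _ _ => 0) (fun _ _ => 0) := by
  refine ⟨?_, ?_, fun _ => isDivFreeC_zero, fun _ => ?_, fun t x => ?_⟩
  · change ContDiffOn ℝ _ (fun _ => (0 : EuclideanSpace ℂ d)) _
    exact contDiffOn_const
  · change ContDiffOn ℝ _ (fun _ => (0 : ℂ)) _
    exact contDiffOn_const
  · simp [FunctionSpaces.Torus.HasZeroMean]
  · have h0 : linearizedNSOperator ν (u t) (0 : UnitAddTorus d → EuclideanSpace ℂ d) 0 x = 0 :=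
      linearizedNSOperator_zero ν (u t) x
    simp only [FunctionSpaces.Torus.timeDerivWithin, derivWithin_univ, deriv_const]
    exact (h0.symm : (0 : EuclideanSpace ℂ d) = _)

variable {ν u}

/-- A virtual period is positive. [folklore] -/
theorem IsVirtualPeriod.pos {T : ℝ} (h : IsVirtualPeriod ν u T) : 0 < T := h.1

/-- A virtual period of `u` is in particular a period of `u`. [folklore] -/
theorem IsVirtualPeriod.periodic {T : ℝ} (h : IsVirtualPeriod ν u T) : Periodic u T := by
  obtain ⟨-, w, q, -, hper, -⟩ := h
  intro t
  exact congrArg Prod.fst (hper t)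

variable (ν) in
/-- **The minimal period is a virtual period** (take `w = 0`; Fiedler 1988, remark after Def. 1.2).
[cite: Fiedler1988, §1.4 after Def. 1.2] -/
theorem isVirtualPeriod_of_minimalPeriod {T : ℝ} (hT : 0 < T) (hper : Periodic u T)
    (hmin : ∀ T', 0 < T' → T' < T → ¬ Periodic u T') : IsVirtualPeriod ν u T := by
  refine ⟨hT, fun _ _ => 0, fun _ _ => 0, isLinearizedNSSolutionAlong_zero ν u, fun t => ?_,
    fun T' hT' hlt hP => hmin T' hT' hlt fun t => congrArg Prod.fst (hP t)⟩
  simp only [hper t]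

end API

/-! ### Complex homogeneity of the linearised operator -/

section Homogeneity

variable {F : Type*} [NormedAddCommGroup F] [NormedSpace ℝ F] [NormedSpace ℂ F] [IsScalarTower ℝ ℂ F]

omit [DecidableEq d] in
/-- `Δ(c w) = c Δw` for a smooth field and a complex constant (Mathlib
`InnerProductSpace.laplacian_smul` on the re-centred lift). [folklore] -/
theorem laplacian_const_smulC {w : UnitAddTorus d → F} (hw : FunctionSpaces.Torus.IsSmooth w) (c : ℂ)
    (x : UnitAddTorus d) :
    FunctionSpaces.Torus.laplacian (fun y => c • w y) x = c • FunctionSpaces.Torus.laplacian w x := by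
  rw [FunctionSpaces.Torus.laplacian, FunctionSpaces.Torus.laplacian,
    show FunctionSpaces.Torus.liftAt (fun y => c • w y) x = c • FunctionSpaces.Torus.liftAt w x from rfl,
    InnerProductSpace.laplacian_smul c
      ((hw.isContDiff (n := 2) (WithTop.coe_le_coe.mpr le_top)).liftAt x).contDiffAt]

omit [DecidableEq d] in
/-- `D(c w) = c Dw` for a `C¹` field and a complex constant (Mathlib `fderiv_const_smul` on the
re-centred lift). [folklore] -/
theorem fderiv_const_smulC {w : UnitAddTorus d → F} (hw : FunctionSpaces.Torus.IsContDiff 1 w) (c : ℂ)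
    (x : UnitAddTorus d) :
    FunctionSpaces.Torus.fderiv (fun y => c • w y) x = c • FunctionSpaces.Torus.fderiv w x := by
  unfold FunctionSpaces.Torus.fderiv
  rw [show FunctionSpaces.Torus.liftAt (fun y => c • w y) x = c • FunctionSpaces.Torus.liftAt w x from rfl]
  exact _root_.fderiv_const_smul ((hw.liftAt x).differentiable one_ne_zero).differentiableAt c

omit [DecidableEq d] in
/-- `(u·∇)(c w) = c (u·∇)w` for a `C¹` field and a complex constant. [folklore] -/
theorem convect_const_smulC (v : UnitAddTorus d → EuclideanSpace ℝ d) {w : UnitAddTorus d → F}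
    (hw : FunctionSpaces.Torus.IsContDiff 1 w) (c : ℂ) (x : UnitAddTorus d) :
    FunctionSpaces.Torus.convect v (fun y => c • w y) x = c • FunctionSpaces.Torus.convect v w x := by
  simp only [FunctionSpaces.Torus.convect]
  rw [fderiv_const_smulC hw c x]
  rfl

/-- `∂ᵢ(c w) = c ∂ᵢw` for a `C¹` field and a complex constant. [folklore] -/
theorem partialDeriv_const_smulC {w : UnitAddTorus d → F} (hw : FunctionSpaces.Torus.IsContDiff 1 w) (c : ℂ)
    (i : d) (x : UnitAddTorus d) :
    FunctionSpaces.Torus.partialDeriv i (fun y => c • w y) x = c • FunctionSpaces.Torus.partialDeriv i w x := by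
  have hcw : FunctionSpaces.Torus.IsContDiff 1 (fun y => c • w y) := ContDiff.const_smul c hw
  rw [FunctionSpaces.Torus.partialDeriv_eq_fderiv_apply hcw, FunctionSpaces.Torus.partialDeriv_eq_fderiv_apply hw,
    fderiv_const_smulC hw c x]
  rfl

omit [DecidableEq d] in
/-- Coordinates of a `C¹` complex vector field are `C¹`. [folklore] -/
theorem isContDiff_apply {w : UnitAddTorus d → EuclideanSpace ℂ d} (hw : FunctionSpaces.Torus.IsContDiff 1 w)
    (i : d) : FunctionSpaces.Torus.IsContDiff 1 (fun y => w y i) :=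
  ((EuclideanSpace.proj i : EuclideanSpace ℂ d →L[ℂ] ℂ).restrictScalars ℝ).contDiff.comp hw

/-- `div(c w) = c div w` for a `C¹` complex field. [folklore] -/
theorem divergenceC_const_smul {w : UnitAddTorus d → EuclideanSpace ℂ d}
    (hw : FunctionSpaces.Torus.IsContDiff 1 w) (c : ℂ) (x : UnitAddTorus d) :
    divergenceC (fun y => c • w y) x = c * divergenceC w x := by
  simp only [divergenceC, Finset.mul_sum]
  refine Finset.sum_congr rfl fun i _ => ?_
  have h := partialDeriv_const_smulC (F := ℂ) (isContDiff_apply hw i) c i x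
  simpa only [PiLp.smul_apply, smul_eq_mul] using h

/-- `((c w)·∇)u_S = c (w·∇)u_S` (the stretching term is linear in `w`, no derivative of `w`). [folklore] -/
theorem stretch_const_smul (w : UnitAddTorus d → EuclideanSpace ℂ d) (uS : UnitAddTorus d → EuclideanSpace ℝ d)
    (c : ℂ) (x : UnitAddTorus d) :
    stretch (fun y => c • w y) uS x = c • stretch w uS x := by
  simp only [stretch, PiLp.smul_apply, smul_eq_mul, mul_smul, Finset.smul_sum]

/-- `∇(c q) = c ∇q` for a `C¹` complex scalar. [folklore] -/
theorem gradientC_const_smul {q : UnitAddTorus d → ℂ} (hq : FunctionSpaces.Torus.IsContDiff 1 q) (c : ℂ)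
    (x : UnitAddTorus d) : gradientC (fun y => c • q y) x = c • gradientC q x := by
  ext i
  simp only [gradientC, PiLp.toLp_apply, PiLp.smul_apply, smul_eq_mul]
  have h := partialDeriv_const_smulC (F := ℂ) hq c i x
  simpa only [smul_eq_mul] using h

/-- **Complex homogeneity of the linearised Navier–Stokes operator**: for smooth `w`, `q` and a
complex constant `c`, `L(ν,u_S)(c w, c q) = c L(ν,u_S)(w, q)`. [folklore] -/
theorem linearizedNSOperator_const_smul (ν : ℝ) (uS : UnitAddTorus d → EuclideanSpace ℝ d)
    {w : UnitAddTorus d → EuclideanSpace ℂ d} {q : UnitAddTorus d → ℂ}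
    (hw : FunctionSpaces.Torus.IsSmooth w) (hq : FunctionSpaces.Torus.IsSmooth q) (c : ℂ) (x : UnitAddTorus d) :
    linearizedNSOperator ν uS (fun y => c • w y) (fun y => c • q y) x =
      c • linearizedNSOperator ν uS w q x := by
  have hw1 : FunctionSpaces.Torus.IsContDiff 1 w := hw.isContDiff (by exact_mod_cast le_top)
  have hq1 : FunctionSpaces.Torus.IsContDiff 1 q := hq.isContDiff (by exact_mod_cast le_top)
  rw [linearizedNSOperator_apply, linearizedNSOperator_apply, laplacian_const_smulC hw c x,
    convect_const_smulC uS hw1 c x, stretch_const_smul w uS c x, gradientC_const_smul hq1 c x,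
    smul_comm ν c, smul_sub, smul_sub, smul_add]

end Homogeneity

/-! ### Normal modes along a steady state; centres have virtual periods -/

section NormalModes

variable {F : Type*} [NormedAddCommGroup F] [NormedSpace ℝ F] [NormedSpace ℂ F] [IsScalarTower ℝ ℂ F]

/-- `d/dt e^{μt} = μ e^{μt}` along the real time axis. [folklore] -/
theorem hasDerivAt_exp_mul_ofReal (μ : ℂ) (t : ℝ) :
    HasDerivAt (fun τ : ℝ => Complex.exp (μ * τ)) (μ * Complex.exp (μ * t)) t := by
  have h1 : HasDerivAt (fun τ : ℝ => μ * (τ : ℂ)) μ t := by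
    simpa using (Complex.ofRealCLM.hasDerivAt (x := t)).const_mul μ
  simpa [mul_comm] using h1.cexp

omit [Fintype d] [DecidableEq d] in
/-- The normal-mode field `(t, y) ↦ e^{μt} g(y)` is jointly smooth for smooth `g`. [folklore] -/
theorem isSmoothSpaceTimeOn_exp_smul [Fintype d] (μ : ℂ) {g : UnitAddTorus d → F}
    (hg : FunctionSpaces.Torus.IsSmooth g) :
    FunctionSpaces.Torus.IsSmoothSpaceTimeOn univ (fun (t : ℝ) y => Complex.exp (μ * t) • g y) := by
  have h : FunctionSpaces.Torus.stLift (fun (t : ℝ) (y : UnitAddTorus d) => Complex.exp (μ * t) • g y) =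
      fun p : ℝ × EuclideanSpace ℝ d => Complex.exp (μ * (p.1 : ℂ)) • FunctionSpaces.Torus.lift g p.2 := by
    funext p; rfl
  unfold FunctionSpaces.Torus.IsSmoothSpaceTimeOn
  rw [h]
  refine ContDiff.contDiffOn (ContDiff.smul ?_ (hg.comp contDiff_snd))
  exact Complex.contDiff_exp.comp
    (contDiff_const.mul (Complex.ofRealCLM.contDiff.comp contDiff_fst))

omit [Fintype d] [DecidableEq d] in
/-- `∂ₜ (e^{μt} g(y)) = μ e^{μt} g(y)`. [folklore] -/
theorem timeDerivWithin_exp_smul (μ : ℂ) (g : UnitAddTorus d → F) (t : ℝ) (x : UnitAddTorus d) :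
    FunctionSpaces.Torus.timeDerivWithin univ (fun (τ : ℝ) y => Complex.exp (μ * τ) • g y) t x =
      (μ * Complex.exp (μ * t)) • g x := by
  simp only [FunctionSpaces.Torus.timeDerivWithin, derivWithin_univ]
  exact ((hasDerivAt_exp_mul_ofReal μ t).smul_const (g x)).deriv

/-- **Normal modes solve the linearised problem along a steady state.** If `(L(ν,u_S) − μ) w₀ = 0`
classically (`Torus.LinNSResolventRel ν u_S μ w₀ 0`, with pressure `q₀`), then
`w(t) = e^{μt} w₀`, `q(t) = e^{μt} q₀` solve `∂ₜw = L(ν,u_S)(w, q)` along the constant solution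
`t ↦ u_S` (Fiedler 1988, (2.4.a): solutions `e^{iβt} y(0)` of the linearised equation).
[cite: Fiedler1988, §2.2 (2.4.a)] -/
theorem isLinearizedNSSolutionAlong_exp_smul {ν : ℝ} {uS : UnitAddTorus d → EuclideanSpace ℝ d} {μ : ℂ}
    {w₀ : UnitAddTorus d → EuclideanSpace ℂ d} (hsm : FunctionSpaces.Torus.IsSmooth w₀) (hdiv : IsDivFreeC w₀)
    (hmean : FunctionSpaces.Torus.HasZeroMean w₀) {q₀ : UnitAddTorus d → ℂ} (hq₀ : FunctionSpaces.Torus.IsSmooth q₀)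
    (heq : ∀ x, linearizedNSOperator ν uS w₀ q₀ x - μ • w₀ x = 0) :
    IsLinearizedNSSolutionAlong ν (fun _ => uS) (fun (t : ℝ) y => Complex.exp (μ * t) • w₀ y)
      (fun (t : ℝ) y => Complex.exp (μ * t) • q₀ y) := by
  refine ⟨isSmoothSpaceTimeOn_exp_smul μ hsm, isSmoothSpaceTimeOn_exp_smul μ hq₀, fun t x => ?_,
    fun t => ?_, fun t x => ?_⟩
  · rw [divergenceC_const_smul (hsm.isContDiff (by exact_mod_cast le_top)), hdiv x, mul_zero]
  · change ∫ x, Complex.exp (μ * t) • w₀ x = 0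
    rw [integral_smul, show ∫ x, w₀ x = 0 from hmean, smul_zero]
  · rw [timeDerivWithin_exp_smul, linearizedNSOperator_const_smul ν uS hsm hq₀,
      show linearizedNSOperator ν uS w₀ q₀ x = μ • w₀ x from sub_eq_zero.mp (heq x), smul_smul,
      mul_comm]

/-- Periodicity of a pair with constant first component is periodicity of the second. [folklore] -/
theorem periodic_pair_const_iff {α β : Type*} (a : α) (g : ℝ → β) (T : ℝ) :
    Periodic (fun t => (a, g t)) T ↔ Periodic g T := by
  constructor
  · intro h t; exact congrArg Prod.snd (h t)
  · intro h t; exact Prod.ext rfl (h t)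

/-- `e^{μT} = 1` for `μ = iβ`, `β ≠ 0`, and `T = 2π/|β|`. [folklore] -/
theorem exp_mul_period_eq_one {μ : ℂ} (hre : μ.re = 0) (him : μ.im ≠ 0) :
    Complex.exp (μ * ((2 * Real.pi / |μ.im| : ℝ) : ℂ)) = 1 := by
  rw [Complex.exp_eq_one_iff]
  rcases lt_or_gt_of_ne him with hneg | hpos
  · refine ⟨-1, ?_⟩
    apply Complex.ext
    · simp [Complex.mul_re, hre]
    · simp only [Complex.mul_im, hre, zero_mul, zero_add, Complex.ofReal_re, abs_of_neg hneg]
      field_simp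
      simp
  · refine ⟨1, ?_⟩
    apply Complex.ext
    · simp [Complex.mul_re, hre]
    · simp only [Complex.mul_im, hre, zero_mul, zero_add, Complex.ofReal_re, abs_of_pos hpos]
      field_simp
      simp

/-- If `e^{μT'} = 1` with `μ = iβ`, `β ≠ 0`, `T' > 0`, then `T' ≥ 2π/|β|`. [folklore] -/
theorem period_le_of_exp_mul_eq_one {μ : ℂ} (hre : μ.re = 0) (him : μ.im ≠ 0) {T' : ℝ} (hT' : 0 < T')
    (h : Complex.exp (μ * (T' : ℂ)) = 1) : 2 * Real.pi / |μ.im| ≤ T' := by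
  obtain ⟨n, hn⟩ := Complex.exp_eq_one_iff.mp h
  have him_eq : μ.im * T' = n * (2 * Real.pi) := by
    have := congrArg Complex.im hn
    simpa [Complex.mul_im, hre] using this
  have hn0 : n ≠ 0 := by
    rintro rfl
    have : μ.im * T' = 0 := by simpa using him_eq
    rcases mul_eq_zero.mp this with h1 | h1
    · exact him h1
    · exact hT'.ne' h1
  have habs : |μ.im| * T' = |(n : ℝ)| * (2 * Real.pi) := by
    have := congrArg abs him_eq
    rwa [abs_mul, abs_mul, abs_of_pos hT', abs_of_pos (by positivity : (0 : ℝ) < 2 * Real.pi)] at this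
  have hn1 : (1 : ℝ) ≤ |(n : ℝ)| := by
    rw [← Int.cast_abs]
    exact_mod_cast Int.one_le_abs hn0
  have hpos : 0 < |μ.im| := abs_pos.mpr him
  rw [div_le_iff₀ hpos]
  calc 2 * Real.pi ≤ |(n : ℝ)| * (2 * Real.pi) := by nlinarith [Real.pi_pos]
    _ = |μ.im| * T' := habs.symm
    _ = T' * |μ.im| := mul_comm _ _

/-- **Centres have virtual periods** (the "if" half of Fiedler 1988, Lemma 4.8): if the
linearisation `L(ν, u_S)` at a steady state has an eigenvalue `μ` with `Re μ = 0`, `μ ≠ 0`, then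
`2π/|Im μ|` is a virtual period of the constant solution `t ↦ u_S` — witnessed by the normal mode
`w(t) = e^{μt} w₀` of an eigenfunction `w₀`, whose pair `(u_S, w(t))` has minimal period `2π/|Im μ|`.
[cite: Fiedler1988, §4 Lemma 4.8] -/
theorem IsLinNSEigenvalue.isVirtualPeriod_const {ν : ℝ} {uS : UnitAddTorus d → EuclideanSpace ℝ d} {μ : ℂ}
    (h : IsLinNSEigenvalue ν uS μ) (hre : μ.re = 0) (hne : μ ≠ 0) :
    IsVirtualPeriod ν (fun _ => uS) (2 * Real.pi / |μ.im|) := by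
  obtain ⟨w₀, hw₀, hsm, hdiv, hmean, q₀, hq₀, heq⟩ := h
  have him : μ.im ≠ 0 := by
    intro him
    exact hne (Complex.ext (by simpa using hre) (by simpa using him))
  have hpos : 0 < 2 * Real.pi / |μ.im| := div_pos (by positivity) (abs_pos.mpr him)
  refine ⟨hpos, fun (t : ℝ) y => Complex.exp (μ * t) • w₀ y, fun (t : ℝ) y => Complex.exp (μ * t) • q₀ y,
    isLinearizedNSSolutionAlong_exp_smul hsm hdiv hmean hq₀ heq, ?_, fun T' hT' hlt hP => ?_⟩
  · -- `T = 2π/|Im μ|` is a period of the pair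
    rw [periodic_pair_const_iff]
    intro t
    funext y
    change Complex.exp (μ * ((t + (2 * Real.pi / |μ.im| : ℝ) : ℝ) : ℂ)) • w₀ y = Complex.exp (μ * (t : ℂ)) • w₀ y
    rw [Complex.ofReal_add, mul_add, Complex.exp_add, exp_mul_period_eq_one hre him, mul_one]
  · -- no smaller positive period: `e^{μT'} = 1` forces `T' ≥ 2π/|Im μ|`
    rw [periodic_pair_const_iff] at hP
    obtain ⟨y₀, hy₀⟩ : ∃ y₀, w₀ y₀ ≠ 0 := Function.ne_iff.mp hw₀
    have h0 := congrFun (hP 0) y₀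
    simp only [zero_add, Complex.ofReal_zero, mul_zero, Complex.exp_zero, one_smul] at h0
    have hexp : Complex.exp (μ * (T' : ℂ)) = 1 := by
      have h1 : (Complex.exp (μ * (T' : ℂ)) - 1) • w₀ y₀ = 0 := by rw [sub_smul, one_smul, h0, sub_self]
      exact sub_eq_zero.mp ((smul_eq_zero.mp h1).resolve_right hy₀)
    exact absurd (period_le_of_exp_mul_eq_one hre him hT' hexp) (not_le.mpr hlt)

end NormalModes

/-! ### Every non-stationary periodic solution has a virtual period (its minimal period) -/

section MinimalPeriod

/-- If each orbit map `t ↦ u t x` is continuous (into a T₂ space), the set of periods is closed. [folklore] -/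
theorem isClosed_setOf_periodic {X F : Type*} [TopologicalSpace F] [T2Space F] (u : ℝ → X → F)
    (hcont : ∀ x, Continuous fun t => u t x) : IsClosed {c : ℝ | Periodic u c} := by
  have h : {c : ℝ | Periodic u c} = ⋂ t, ⋂ x, {c | u (t + c) x = u t x} := by
    ext c
    simp only [Set.mem_iInter, Set.mem_setOf_eq]
    exact ⟨fun hc t x => congrFun (hc t) x, fun hc t => funext fun x => hc t x⟩
  rw [h]
  refine isClosed_iInter fun t => isClosed_iInter fun x => ?_
  exact isClosed_eq ((hcont x).comp (continuous_const.add continuous_id)) continuous_const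

/-- **A continuous-in-time, periodic, non-stationary field has a minimal period**, not exceeding
any given period: the periods form a closed additive subgroup of `ℝ` which is not dense (else every
real number is a period and `u` is constant in time), hence cyclic (Mathlib
`AddSubgroup.dense_or_cyclic`), and the minimal period is the absolute value of a generator. [folklore] -/
theorem exists_minimalPeriod {X F : Type*} [TopologicalSpace F] [T2Space F] {u : ℝ → X → F}
    (hcont : ∀ x, Continuous fun t => u t x) {T : ℝ} (hT : 0 < T) (hper : Periodic u T)
    (hns : ∃ t, u t ≠ u 0) :
    ∃ T₀, 0 < T₀ ∧ T₀ ≤ T ∧ Periodic u T₀ ∧ ∀ T', 0 < T' → T' < T₀ → ¬ Periodic u T' := by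
  -- the additive subgroup of periods
  let S : AddSubgroup ℝ :=
    { carrier := {c | Periodic u c}
      zero_mem' := fun t => by simp
      add_mem' := fun {a b} ha hb t => by
        change u (t + (a + b)) = u t
        rw [← add_assoc, hb (t + a), ha t]
      neg_mem' := fun {a} ha => ha.neg }
  have hmemS : ∀ c, c ∈ S ↔ Periodic u c := fun c => Iff.rfl
  have hcoe : (S : Set ℝ) = {c | Periodic u c} := rfl
  rcases AddSubgroup.dense_or_cyclic S with hdense | ⟨a, ha⟩
  · -- dense and closed: every real number is a period, so `u` is stationary
    exfalso
    obtain ⟨t, ht⟩ := hns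
    have hall : (S : Set ℝ) = Set.univ := by
      rw [← hdense.closure_eq, hcoe, (isClosed_setOf_periodic u hcont).closure_eq]
    have htS : t ∈ S := by
      rw [← SetLike.mem_coe, hall]; exact Set.mem_univ t
    exact ht (by simpa using ((hmemS t).mp htS) 0)
  · -- cyclic with generator `a ≠ 0`; the minimal period is `|a|`
    have hmem : ∀ c, c ∈ S ↔ ∃ n : ℤ, n • a = c := fun c => by
      rw [ha, AddSubgroup.mem_closure_singleton]
    have hTS : T ∈ S := (hmemS T).mpr hper
    obtain ⟨n, hn⟩ := (hmem T).mp hTS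
    have ha0 : a ≠ 0 := by
      rintro rfl
      simp at hn
      exact hT.ne' hn.symm
    have haS : a ∈ S := (hmem a).mpr ⟨1, one_zsmul a⟩
    have habsS : |a| ∈ S := by
      rcases abs_choice a with h | h <;> rw [h]
      · exact haS
      · exact S.neg_mem haS
    refine ⟨|a|, abs_pos.mpr ha0, ?_, (hmemS _).mp habsS, fun T' hT' hlt hP => ?_⟩
    · -- `T = n • a` with `n ≠ 0`, so `|a| ≤ |T| = T`
      have hn0 : n ≠ 0 := by
        rintro rfl
        simp at hn
        exact hT.ne' hn.symm
      calc |a| ≤ |(n : ℝ)| * |a| := le_mul_of_one_le_left (abs_nonneg a)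
            (by rw [← Int.cast_abs]; exact_mod_cast Int.one_le_abs hn0)
        _ = |T| := by rw [← abs_mul, ← hn, zsmul_eq_mul]
        _ = T := abs_of_pos hT
    · -- a period `T' ∈ (0, |a|)` would be `m • a` with `m ≠ 0`, forcing `|T'| ≥ |a|`
      obtain ⟨m, hm⟩ := (hmem T').mp ((hmemS T').mpr hP)
      have hm0 : m ≠ 0 := by
        rintro rfl
        simp at hm
        exact hT'.ne' hm.symm
      have : |a| ≤ T' := by
        calc |a| ≤ |(m : ℝ)| * |a| := le_mul_of_one_le_left (abs_nonneg a)
              (by rw [← Int.cast_abs]; exact_mod_cast Int.one_le_abs hm0)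
          _ = |T'| := by rw [← abs_mul, ← hm, zsmul_eq_mul]
          _ = T' := abs_of_pos hT'
      exact absurd this (not_le.mpr hlt)

/-- **Every continuous-in-time, non-stationary, time-periodic `u` has a virtual period** — its
minimal period (`exists_minimalPeriod` with `isVirtualPeriod_of_minimalPeriod`); in particular every
genuinely periodic classical Navier–Stokes solution carries at least one virtual period
(Fiedler 1988, remark after Def. 1.2). [cite: Fiedler1988, §1.4 after Def. 1.2] -/
theorem exists_isVirtualPeriod (ν : ℝ) {u : ℝ → UnitAddTorus d → EuclideanSpace ℝ d}
    (hcont : ∀ x, Continuous fun t => u t x) {T : ℝ} (hT : 0 < T) (hper : Periodic u T)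
    (hns : ∃ t, u t ≠ u 0) : ∃ T₀, 0 < T₀ ∧ T₀ ≤ T ∧ IsVirtualPeriod ν u T₀ := by
  obtain ⟨T₀, h0, hle, hP, hmin⟩ := exists_minimalPeriod hcont hT hper hns
  exact ⟨T₀, h0, hle, isVirtualPeriod_of_minimalPeriod ν h0 hP hmin⟩

end MinimalPeriod

end Torus

end Literature.Analysis.FluidPDE

end
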